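import Summits.NavierStokesRegularity.NavierStokesRegularity.Theorems.CircuitTrace.Negative.Structure
import Summits.NavierStokesRegularity.NavierStokesRegularity.Theorems.PerpetualPumpCircuitTraceValveBudgetIdentity

/-!
# The tilted Grönwall lever for the low block of a Tao circuit
# (crux `PerpetualPump.CircuitTrace`, stmt-NavierStokesRegularity-1836;
# line `tilted-trace-gronwall`, stub S4)

For Tao's viscous circuit (4.3) at `α = 2/5` (`circuitRHS` of
`Theorems/CircuitTrace/Negative/LoadBearing.lean`) and every `lam > 1`, tilt `β`, `coeff`,
amplitude bound `A` there is `Γ = Γ(lam,β,m,coeff,A) ≥ 0` with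
`e^{-Γ lam^{4N/5}(t₂-t₁)} L^β_N(t₁) ≤ L^β_N(t₂)` for `0 < t₁ ≤ t₂ < T`, where
`L^β_N(t) = Σ_{k=0}^{N} Σ_i lam^{2βk} X_{i,k}(t)²`, in every solution with `lam^{n/5}|X_{i,n}| ≤ A`
on `[0,T)` and no modes below scale `0` (`stub_tiltedGronwall`): the low block cannot be depleted
faster than at the clock of its top scale. Proof (one-sided coupling + Young; no cancellation,
symmetry or a-priori bound): every monomial of `Ẋ_{i,k}`, `k ≤ N`, has besides `X_{i,k}` a factor
at a scale `≤ N`; the third factor is `≤ A⁺ = max A 0` in critical units, the `(k-1)²`-source is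
re-weighted at price `lam^{2β}`, so `L̇ ≥ -Γ lam^{4N/5} L` with `Γ = 2 + K A⁺ m² (7 + lam^{2β})`;
integrating factor.
The expansion of `circuitRHS` into its four offset families is the landed
`valveBudget_circuitRHS_expand` (`Theorems/PerpetualPumpCircuitTraceValveBudgetIdentity.lean`).
[folklore]
-/

noncomputable section

-- the summit namespace `…NavierStokesRegularity.NavierStokesRegularity…` is the tree convention
set_option linter.dupNamespace false

namespace Summit.NavierStokesRegularity.NavierStokesRegularity.Theorems.PerpetualPumpCircuitTrace

open Finset Real Set
open Summit.NavierStokesRegularity.NavierStokesRegularity.Theorems.CircuitTrace.Negative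

/-- Far-factor bound: a critical amplitude bound `lam^{s/5}|y| ≤ A'` turns the weighted factor
`lam^e |y|` into `≤ A' lam^M` as soon as `e ≤ M + s/5` (`lam ≥ 1`). -/
theorem tiltedGronwall_far {lam : ℝ} (hlam : 1 ≤ lam) {A' e s M y : ℝ}
    (hy : lam ^ ((1 / 5 : ℝ) * s) * |y| ≤ A') (he : e ≤ M + (1 / 5 : ℝ) * s) :
    lam ^ e * |y| ≤ A' * lam ^ M := by
  have hlam0 : 0 < lam := by linarith
  have h1 : lam ^ e = lam ^ (e - (1 / 5 : ℝ) * s) * lam ^ ((1 / 5 : ℝ) * s) := by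
    rw [← Real.rpow_add hlam0]; ring_nf
  have h2 : lam ^ (e - (1 / 5 : ℝ) * s) ≤ lam ^ M :=
    Real.rpow_le_rpow_of_exponent_le hlam (by linarith)
  calc lam ^ e * |y| = lam ^ (e - (1 / 5 : ℝ) * s) * (lam ^ ((1 / 5 : ℝ) * s) * |y|) := by
        rw [h1, mul_assoc]
    _ ≤ lam ^ M * A' :=
        mul_le_mul h2 hy (mul_nonneg (Real.rpow_pos_of_pos hlam0 _).le (abs_nonneg _))
          (Real.rpow_pos_of_pos hlam0 _).le
    _ = A' * lam ^ M := mul_comm _ _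

/-- One monomial (Young): `|2 W x (c P y z)| ≤ K B (W x² + W z²)` when `|c| ≤ K` and the far
factor obeys `P |y| ≤ B`. -/
theorem tiltedGronwall_monomial {W x c P y z K B : ℝ} (hW : 0 ≤ W) (hK0 : 0 ≤ K) (hB0 : 0 ≤ B)
    (hP : 0 ≤ P) (hc : |c| ≤ K) (hy : P * |y| ≤ B) :
    |2 * W * x * (c * P * y * z)| ≤ K * B * (W * x ^ 2 + W * z ^ 2) := by
  have h1 : |2 * W * x * (c * P * y * z)| = 2 * W * (|c| * (P * |y|)) * (|x| * |z|) := by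
    rw [abs_mul, abs_mul, abs_mul, abs_mul, abs_mul, abs_mul, abs_of_nonneg hW, abs_of_nonneg hP,
      abs_two]
    ring
  have h2 : |c| * (P * |y|) ≤ K * B := mul_le_mul hc hy (mul_nonneg hP (abs_nonneg _)) hK0
  have h3 : 2 * (|x| * |z|) ≤ x ^ 2 + z ^ 2 := by
    have := two_mul_le_add_sq |x| |z|
    rw [sq_abs, sq_abs] at this
    linarith
  have hxz : 0 ≤ |x| * |z| := mul_nonneg (abs_nonneg _) (abs_nonneg _)
  calc |2 * W * x * (c * P * y * z)| = 2 * W * (|c| * (P * |y|)) * (|x| * |z|) := h1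
    _ ≤ 2 * W * (K * B) * (|x| * |z|) := by gcongr
    _ = K * B * W * (2 * (|x| * |z|)) := by ring
    _ ≤ K * B * W * (x ^ 2 + z ^ 2) := by gcongr
    _ = K * B * (W * x ^ 2 + W * z ^ 2) := by ring

/-- A double sum of monomials with far factor `Y i₁` (`P |Y i₁| ≤ B`) and block factor `Z i₂`:
`|2 W x · P Σ_{i₁,i₂} c Y Z| ≤ K B (m² W x² + m Σ_{i₂} W Z_{i₂}²)`. -/
theorem tiltedGronwall_pairSum_far_left {m : ℕ} (c : Fin m → Fin m → ℝ) (Y Z : Fin m → ℝ)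
    {W x P K B : ℝ} (hW : 0 ≤ W) (hK0 : 0 ≤ K) (hB0 : 0 ≤ B) (hP : 0 ≤ P)
    (hc : ∀ i₁ i₂, |c i₁ i₂| ≤ K) (hY : ∀ i₁, P * |Y i₁| ≤ B) :
    |2 * W * x * (P * ∑ i₁ : Fin m, ∑ i₂ : Fin m, c i₁ i₂ * Y i₁ * Z i₂)|
      ≤ K * B * ((m : ℝ) ^ 2 * (W * x ^ 2) + m * ∑ i₂ : Fin m, W * Z i₂ ^ 2) := by
  have hexp : 2 * W * x * (P * ∑ i₁ : Fin m, ∑ i₂ : Fin m, c i₁ i₂ * Y i₁ * Z i₂)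
      = ∑ i₁ : Fin m, ∑ i₂ : Fin m, 2 * W * x * (c i₁ i₂ * P * Y i₁ * Z i₂) := by
    simp only [Finset.mul_sum]
    refine Finset.sum_congr rfl fun i₁ _ => Finset.sum_congr rfl fun i₂ _ => by ring
  rw [hexp]
  refine (Finset.abs_sum_le_sum_abs _ _).trans ?_
  refine (Finset.sum_le_sum fun i₁ _ => Finset.abs_sum_le_sum_abs _ _).trans ?_
  refine (Finset.sum_le_sum fun i₁ _ => Finset.sum_le_sum fun i₂ _ =>
    tiltedGronwall_monomial hW hK0 hB0 hP (hc i₁ i₂) (hY i₁)).trans ?_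
  refine le_of_eq ?_
  simp only [Finset.sum_add_distrib, Finset.sum_const, Finset.card_univ, Fintype.card_fin,
    nsmul_eq_mul, ← Finset.mul_sum]
  ring

/-- The same double sum with far factor `Z i₂` (`P |Z i₂| ≤ B`) and block factor `Y i₁`. -/
theorem tiltedGronwall_pairSum_far_right {m : ℕ} (c : Fin m → Fin m → ℝ) (Y Z : Fin m → ℝ)
    {W x P K B : ℝ} (hW : 0 ≤ W) (hK0 : 0 ≤ K) (hB0 : 0 ≤ B) (hP : 0 ≤ P)
    (hc : ∀ i₁ i₂, |c i₁ i₂| ≤ K) (hZ : ∀ i₂, P * |Z i₂| ≤ B) :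
    |2 * W * x * (P * ∑ i₁ : Fin m, ∑ i₂ : Fin m, c i₁ i₂ * Y i₁ * Z i₂)|
      ≤ K * B * ((m : ℝ) ^ 2 * (W * x ^ 2) + m * ∑ i₁ : Fin m, W * Y i₁ ^ 2) := by
  have hswap : ∑ i₁ : Fin m, ∑ i₂ : Fin m, c i₁ i₂ * Y i₁ * Z i₂
      = ∑ i₂ : Fin m, ∑ i₁ : Fin m, (fun a b => c b a) i₂ i₁ * Z i₂ * Y i₁ := by
    rw [Finset.sum_comm]
    exact Finset.sum_congr rfl fun i₂ _ => Finset.sum_congr rfl fun i₁ _ => by ring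
  rw [hswap]
  exact tiltedGronwall_pairSum_far_left (fun a b => c b a) Z Y hW hK0 hB0 hP (fun a b => hc b a) hZ

/-- Bookkeeping of the block sums: per-mode lower bounds
`F_{k,i} ≥ -C₀ (a G_{k,i} + b E_k + c E'_k)` with `E_k = Σ_i G_{k,i}` and `Σ_k E'_k ≤ Σ_k E_k` sum
to `Σ_{k,i} F ≥ -C₀ (a + m b + m c) Σ_k E_k`. -/
theorem tiltedGronwall_bookkeeping {m N : ℕ} (F G : ℕ → Fin m → ℝ) (E E' : ℕ → ℝ)
    {a b c C₀ : ℝ} (hE : ∀ k, E k = ∑ i : Fin m, G k i)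
    (hmode : ∀ k ∈ Finset.range (N + 1), ∀ i : Fin m,
      -(C₀ * (a * G k i + (b * E k + c * E' k))) ≤ F k i)
    (hC₀ : 0 ≤ C₀) (hc : 0 ≤ c)
    (hshift : ∑ k ∈ Finset.range (N + 1), E' k ≤ ∑ k ∈ Finset.range (N + 1), E k) :
    -(C₀ * (a + m * b + m * c) * ∑ k ∈ Finset.range (N + 1), E k)
      ≤ ∑ k ∈ Finset.range (N + 1), ∑ i : Fin m, F k i := by
  have h1 : ∀ k ∈ Finset.range (N + 1),
      -(C₀ * ((a + m * b) * E k + m * c * E' k)) ≤ ∑ i : Fin m, F k i := by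
    intro k hk
    have heq : ∑ i : Fin m, -(C₀ * (a * G k i + (b * E k + c * E' k)))
        = -(C₀ * ((a + m * b) * E k + m * c * E' k)) := by
      rw [Finset.sum_neg_distrib, ← Finset.mul_sum, Finset.sum_add_distrib, ← Finset.mul_sum,
        Finset.sum_const, Finset.card_univ, Fintype.card_fin, nsmul_eq_mul, ← hE]
      ring
    rw [← heq]
    exact Finset.sum_le_sum fun i _ => hmode k hk i
  have h2 := Finset.sum_le_sum h1
  have h3 : ∑ k ∈ Finset.range (N + 1), -(C₀ * ((a + m * b) * E k + m * c * E' k))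
      = -(C₀ * ((a + m * b) * ∑ k ∈ Finset.range (N + 1), E k
          + m * c * ∑ k ∈ Finset.range (N + 1), E' k)) := by
    rw [Finset.sum_neg_distrib, ← Finset.mul_sum, Finset.sum_add_distrib, ← Finset.mul_sum,
      ← Finset.mul_sum]
  rw [h3] at h2
  have h4 : C₀ * (m * c) * ∑ k ∈ Finset.range (N + 1), E' k
      ≤ C₀ * (m * c) * ∑ k ∈ Finset.range (N + 1), E k :=
    mul_le_mul_of_nonneg_left hshift (by positivity)
  linarith

/-- Re-indexing the `(k-1)`-block: with the cutoff `X_{·,-1} = 0`,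
`Σ_{k ≤ N} Σ_i lam^{2β(k-1)} X_{i,k-1}² ≤ Σ_{k ≤ N} Σ_i lam^{2βk} X_{i,k}²`. -/
theorem tiltedGronwall_shift_le {lam : ℝ} (hlam0 : 0 < lam) (β : ℝ) {m : ℕ}
    (X : Fin m → ℤ → ℝ → ℝ) (t : ℝ) (hcut : ∀ (i : Fin m) (n : ℤ), n < 0 → X i n t = 0) (N : ℕ) :
    ∑ k ∈ Finset.range (N + 1), ∑ i : Fin m, lam ^ (2 * β * ((k : ℝ) - 1)) * X i ((k : ℤ) - 1) t ^ 2
      ≤ ∑ k ∈ Finset.range (N + 1), ∑ i : Fin m, lam ^ (2 * β * k) * X i k t ^ 2 := by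
  rw [Finset.sum_range_succ' (fun k => ∑ i : Fin m,
    lam ^ (2 * β * ((k : ℝ) - 1)) * X i ((k : ℤ) - 1) t ^ 2)]
  have h0 : ∑ i : Fin m,
      lam ^ (2 * β * (((0 : ℕ) : ℝ) - 1)) * X i (((0 : ℕ) : ℤ) - 1) t ^ 2 = 0 := by
    refine Finset.sum_eq_zero fun i _ => ?_
    have : X i (((0 : ℕ) : ℤ) - 1) t = 0 := hcut i _ (by norm_num)
    rw [this]; ring
  have hshift : ∀ k : ℕ, ∑ i : Fin m, lam ^ (2 * β * (((k + 1 : ℕ) : ℝ) - 1)) *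
      X i (((k + 1 : ℕ) : ℤ) - 1) t ^ 2 = ∑ i : Fin m, lam ^ (2 * β * k) * X i k t ^ 2 := by
    intro k
    push_cast
    simp only [add_sub_cancel_right]
  rw [h0, add_zero, Finset.sum_congr rfl fun k _ => hshift k]
  refine Finset.sum_le_sum_of_subset_of_nonneg (Finset.range_subset_range.mpr (Nat.le_succ N)) ?_
  intro k _ _
  exact Finset.sum_nonneg fun i _ => mul_nonneg (Real.rpow_pos_of_pos hlam0 _).le (sq_nonneg _)

/-- Per-mode lower bound (one-sided coupling + Young). For `k ≤ N`, with
`|X_{i',j}| ≤ A' lam^{-j/5}` for all modes, `lam^{2βk} · 2 X_{i,k} Ẋ_{i,k}` is bounded below by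
`-lam^{4N/5} · ((2 + 4 K A' m²) lam^{2βk} X_{i,k}² + 3 K A' m · E_k + K A' m lam^{2β} · E'_{k-1})`,
`E_k = Σ_{i₂} lam^{2βk} X_{i₂,k}²`, `E'_{k-1} = Σ_{i₂} lam^{2β(k-1)} X_{i₂,k-1}²`. -/
theorem tiltedGronwall_mode {lam : ℝ} (hlam : 1 ≤ lam) (β : ℝ) {m : ℕ}
    (coeff : Fin m → Fin m → Fin m → Option (Fin 3) → ℝ) {K : ℝ} (hK0 : 0 ≤ K)
    (hK : ∀ i₁ i₂ i₃ μ, |coeff i₁ i₂ i₃ μ| ≤ K) (X : Fin m → ℤ → ℝ → ℝ) (t : ℝ) {A' : ℝ}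
    (hA'0 : 0 ≤ A') (hamp : ∀ (i : Fin m) (j : ℤ), lam ^ ((1 / 5 : ℝ) * j) * |X i j t| ≤ A')
    {N k : ℕ} (hk : k ≤ N) (i : Fin m) :
    -(lam ^ ((4 / 5 : ℝ) * N) *
        ((2 + 4 * K * A' * (m : ℝ) ^ 2) * (lam ^ (2 * β * k) * X i k t ^ 2)
          + (3 * K * A' * m * ∑ i₂ : Fin m, lam ^ (2 * β * k) * X i₂ k t ^ 2
            + K * A' * m * lam ^ (2 * β) *
                ∑ i₂ : Fin m, lam ^ (2 * β * ((k : ℝ) - 1)) * X i₂ ((k : ℤ) - 1) t ^ 2)))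
      ≤ lam ^ (2 * β * k) * (2 * X i k t * circuitRHS lam coeff X i k t) := by
  have hlam0 : 0 < lam := by linarith
  have hW : 0 ≤ lam ^ (2 * β * k) := (Real.rpow_pos_of_pos hlam0 _).le
  have hP : 0 ≤ lam ^ (k : ℝ) := (Real.rpow_pos_of_pos hlam0 _).le
  have hP' : 0 ≤ lam ^ ((k : ℝ) - 1) := (Real.rpow_pos_of_pos hlam0 _).le
  have hC₀ : 0 ≤ lam ^ ((4 / 5 : ℝ) * N) := (Real.rpow_pos_of_pos hlam0 _).le
  have hB0 : 0 ≤ A' * lam ^ ((4 / 5 : ℝ) * N) := mul_nonneg hA'0 hC₀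
  have hkR : (k : ℝ) ≤ N := by exact_mod_cast hk
  -- far-factor bounds (critical amplitude `≤ A'` at scales `k`, `k+1`, `k-1`)
  have hfar0 : ∀ i₁ : Fin m, lam ^ (k : ℝ) * |X i₁ k t| ≤ A' * lam ^ ((4 / 5 : ℝ) * N) := by
    intro i₁
    have h := hamp i₁ k
    simp only [Int.cast_natCast] at h
    exact tiltedGronwall_far hlam h (by linarith)
  have hfar1 : ∀ i₁ : Fin m, lam ^ (k : ℝ) * |X i₁ ((k : ℤ) + 1) t|
      ≤ A' * lam ^ ((4 / 5 : ℝ) * N) := by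
    intro i₁
    have h := hamp i₁ ((k : ℤ) + 1)
    push_cast at h
    exact tiltedGronwall_far hlam h (by linarith)
  have hfar2 : ∀ i₁ : Fin m, lam ^ ((k : ℝ) - 1) * |X i₁ ((k : ℤ) - 1) t|
      ≤ A' * lam ^ ((4 / 5 : ℝ) * N) := by
    intro i₁
    have h := hamp i₁ ((k : ℤ) - 1)
    push_cast at h
    exact tiltedGronwall_far hlam h (by linarith)
  -- the four offset families
  have hS₀ := tiltedGronwall_pairSum_far_left (fun i₁ i₂ => coeff i₁ i₂ i none)
    (fun i₁ => X i₁ k t) (fun i₂ => X i₂ k t) (x := X i k t) hW hK0 hB0 hP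
    (fun i₁ i₂ => hK i₁ i₂ i none) hfar0
  have hS₁ := tiltedGronwall_pairSum_far_left (fun i₁ i₂ => coeff i₁ i₂ i (some 0))
    (fun i₁ => X i₁ ((k : ℤ) + 1) t) (fun i₂ => X i₂ k t) (x := X i k t) hW hK0 hB0 hP
    (fun i₁ i₂ => hK i₁ i₂ i (some 0)) hfar1
  have hS₂ := tiltedGronwall_pairSum_far_right (fun i₁ i₂ => coeff i₁ i₂ i (some 1))
    (fun i₁ => X i₁ k t) (fun i₂ => X i₂ ((k : ℤ) + 1) t) (x := X i k t) hW hK0 hB0 hP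
    (fun i₁ i₂ => hK i₁ i₂ i (some 1)) hfar1
  have hS₃ := tiltedGronwall_pairSum_far_left (fun i₁ i₂ => coeff i₁ i₂ i (some 2))
    (fun i₁ => X i₁ ((k : ℤ) - 1) t) (fun i₂ => X i₂ ((k : ℤ) - 1) t) (x := X i k t) hW hK0 hB0
    hP' (fun i₁ i₂ => hK i₁ i₂ i (some 2)) hfar2
  -- the linear (dissipation) part: `lam^{4k/5} ≤ lam^{4N/5}`
  have hlin : lam ^ ((4 / 5 : ℝ) * k) * (lam ^ (2 * β * k) * X i k t ^ 2)
      ≤ lam ^ ((4 / 5 : ℝ) * N) * (lam ^ (2 * β * k) * X i k t ^ 2) :=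
    mul_le_mul_of_nonneg_right (Real.rpow_le_rpow_of_exponent_le hlam (by linarith))
      (mul_nonneg hW (sq_nonneg _))
  -- re-weighting of the `(k-1)`-block at price `lam^{2β}`
  have hW' : ∑ i₂ : Fin m, lam ^ (2 * β * k) * X i₂ ((k : ℤ) - 1) t ^ 2
      = lam ^ (2 * β) * ∑ i₂ : Fin m, lam ^ (2 * β * ((k : ℝ) - 1)) * X i₂ ((k : ℤ) - 1) t ^ 2 := by
    rw [Finset.mul_sum]
    refine Finset.sum_congr rfl fun i₂ _ => ?_
    rw [← mul_assoc, ← Real.rpow_add hlam0]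
    ring_nf
  rw [hW'] at hS₃
  rw [valveBudget_circuitRHS_expand]
  simp only [Int.cast_natCast]
  have h0 := (abs_le.mp hS₀).1
  have h1 := (abs_le.mp hS₁).1
  have h2 := (abs_le.mp hS₂).1
  have h3 := (abs_le.mp hS₃).1
  have hsq : 0 ≤ lam ^ (2 * β * k) * X i k t ^ 2 := mul_nonneg hW (sq_nonneg _)
  have hE : 0 ≤ ∑ i₂ : Fin m, lam ^ (2 * β * k) * X i₂ k t ^ 2 :=
    Finset.sum_nonneg fun i₂ _ => mul_nonneg hW (sq_nonneg _)
  have hKA : 0 ≤ K * (A' * lam ^ ((4 / 5 : ℝ) * N)) := mul_nonneg hK0 hB0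
  nlinarith [mul_nonneg hKA hsq, mul_nonneg hKA hE]

/-- Summed form: at an instant where every mode obeys `lam^{j/5}|X_{i,j}| ≤ A'` and the cutoff
`X_{·,<0} = 0` holds, `Σ_{k ≤ N} Σ_i lam^{2βk} · 2 X_{i,k} Ẋ_{i,k} ≥ -Γ₀ lam^{4N/5} L^β_N` with
`Γ₀ = 2 + K A' m² (7 + lam^{2β})`. -/
theorem tiltedGronwall_deriv_lower {lam : ℝ} (hlam : 1 ≤ lam) (β : ℝ) {m : ℕ}
    (coeff : Fin m → Fin m → Fin m → Option (Fin 3) → ℝ) {K : ℝ} (hK0 : 0 ≤ K)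
    (hK : ∀ i₁ i₂ i₃ μ, |coeff i₁ i₂ i₃ μ| ≤ K) (X : Fin m → ℤ → ℝ → ℝ) (t : ℝ) {A' : ℝ}
    (hA'0 : 0 ≤ A') (hamp : ∀ (i : Fin m) (j : ℤ), lam ^ ((1 / 5 : ℝ) * j) * |X i j t| ≤ A')
    (hcut : ∀ (i : Fin m) (n : ℤ), n < 0 → X i n t = 0) (N : ℕ) :
    -((2 + K * A' * (m : ℝ) ^ 2 * (7 + lam ^ (2 * β))) * lam ^ ((4 / 5 : ℝ) * N) *
        ∑ k ∈ Finset.range (N + 1), ∑ i : Fin m, lam ^ (2 * β * k) * X i k t ^ 2)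
      ≤ ∑ k ∈ Finset.range (N + 1), ∑ i : Fin m,
          lam ^ (2 * β * k) * (2 * X i k t * circuitRHS lam coeff X i k t) := by
  have hlam0 : 0 < lam := by linarith
  have hC₀ : 0 ≤ lam ^ ((4 / 5 : ℝ) * N) := (Real.rpow_pos_of_pos hlam0 _).le
  have hc : 0 ≤ K * A' * m * lam ^ (2 * β) := by
    have : 0 ≤ lam ^ (2 * β) := (Real.rpow_pos_of_pos hlam0 _).le
    positivity
  have hbook := tiltedGronwall_bookkeeping (N := N)
    (fun k j => lam ^ (2 * β * k) * (2 * X j k t * circuitRHS lam coeff X j k t))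
    (fun k j => lam ^ (2 * β * k) * X j k t ^ 2)
    (fun k => ∑ j : Fin m, lam ^ (2 * β * k) * X j k t ^ 2)
    (fun k => ∑ j : Fin m, lam ^ (2 * β * ((k : ℝ) - 1)) * X j ((k : ℤ) - 1) t ^ 2)
    (a := 2 + 4 * K * A' * (m : ℝ) ^ 2) (b := 3 * K * A' * m) (c := K * A' * m * lam ^ (2 * β))
    (C₀ := lam ^ ((4 / 5 : ℝ) * N)) (fun k => rfl)
    (fun k hk j => tiltedGronwall_mode hlam β coeff hK0 hK X t hA'0 hamp
      (Nat.lt_succ_iff.mp (Finset.mem_range.mp hk)) j)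
    hC₀ hc (tiltedGronwall_shift_le hlam0 β X t hcut N)
  have hL : 0 ≤ ∑ k ∈ Finset.range (N + 1), ∑ i : Fin m, lam ^ (2 * β * k) * X i k t ^ 2 :=
    Finset.sum_nonneg fun k _ => Finset.sum_nonneg fun i _ =>
      mul_nonneg (Real.rpow_pos_of_pos hlam0 _).le (sq_nonneg _)
  have key : (2 + K * A' * (m : ℝ) ^ 2 * (7 + lam ^ (2 * β))) * lam ^ ((4 / 5 : ℝ) * N)
      = lam ^ ((4 / 5 : ℝ) * N) *
        (2 + 4 * K * A' * (m : ℝ) ^ 2 + m * (3 * K * A' * m)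
          + m * (K * A' * m * lam ^ (2 * β))) := by
    ring
  rw [key]
  exact hbook

/-- **S4, the TILTED GRÖNWALL LEVER** (line `tilted-trace-gronwall` of crux
`PerpetualPump.CircuitTrace`).
For every `lam > 1`, tilt `β`, circuit `coeff` and amplitude bound `A` there is
`Γ = Γ(lam,β,m,coeff,A) ≥ 0` such that in every solution of the circuit on `(0,T)` with
`lam^{n/5}|X_{i,n}| ≤ A` on `[0,T)` and no modes below scale `0`, the tilted low-block energy
`L^β_N(t) = Σ_{k=0}^{N} Σ_i lam^{2βk} X_{i,k}(t)²` obeys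
`e^{-Γ lam^{4N/5}(t₂-t₁)} L^β_N(t₁) ≤ L^β_N(t₂)` for `0 < t₁ ≤ t₂ < T`.
Here `Γ = 2 + K A⁺ m² (7 + lam^{2β})`, `K = max |coeff|`, `A⁺ = max A 0`. -/
theorem stub_tiltedGronwall :
    ∀ lam : ℝ, 1 < lam → ∀ (β : ℝ) (m : ℕ) (coeff : Fin m → Fin m → Fin m → Option (Fin 3) → ℝ) (A : ℝ),
    ∃ Γ : ℝ, 0 ≤ Γ ∧ ∀ (T : ℝ) (X : Fin m → ℤ → ℝ → ℝ),
    (∀ (i : Fin m) (n : ℤ), ∀ t ∈ Set.Ioo 0 T, HasDerivAt (X i n) (circuitRHS lam coeff X i n t) t) →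
    (∀ (i : Fin m) (n : ℤ) (t : ℝ), n < 0 → X i n t = 0) →
    (∀ t ∈ Set.Ico 0 T, ∀ (i : Fin m) (n : ℤ), lam ^ ((1 / 5 : ℝ) * n) * |X i n t| ≤ A) →
    ∀ (N : ℕ) (t₁ t₂ : ℝ), 0 < t₁ → t₁ ≤ t₂ → t₂ < T →
    Real.exp (-(Γ * lam ^ ((4 / 5 : ℝ) * N) * (t₂ - t₁))) *
        (∑ k ∈ Finset.range (N + 1), ∑ i : Fin m, lam ^ (2 * β * k) * (X i k t₁) ^ 2)
      ≤ ∑ k ∈ Finset.range (N + 1), ∑ i : Fin m, lam ^ (2 * β * k) * (X i k t₂) ^ 2 := by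
  intro lam hlam β m coeff A
  obtain ⟨K, hK0, hK⟩ := exists_coeff_bound coeff
  have hlam1 : 1 ≤ lam := hlam.le
  have hlam0 : 0 < lam := by linarith
  have hA'0 : 0 ≤ max A 0 := le_max_right _ _
  have h2β : 0 ≤ lam ^ (2 * β) := (Real.rpow_pos_of_pos hlam0 _).le
  refine ⟨2 + K * max A 0 * (m : ℝ) ^ 2 * (7 + lam ^ (2 * β)), by positivity, ?_⟩
  intro T X hderiv hcut hA N t₁ t₂ ht₁ ht₁₂ ht₂T
  -- abbreviations: the rate `C`, the block energy `L` and its derivative `L'`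
  set C : ℝ := (2 + K * max A 0 * (m : ℝ) ^ 2 * (7 + lam ^ (2 * β))) * lam ^ ((4 / 5 : ℝ) * N)
    with hCdef
  set L : ℝ → ℝ := fun t => ∑ k ∈ Finset.range (N + 1), ∑ i : Fin m,
    lam ^ (2 * β * k) * X i k t ^ 2 with hLdef
  set L' : ℝ → ℝ := fun t => ∑ k ∈ Finset.range (N + 1), ∑ i : Fin m,
    lam ^ (2 * β * k) * (2 * X i k t * circuitRHS lam coeff X i k t) with hL'def
  have hIoo : ∀ t ∈ Set.Icc t₁ t₂, t ∈ Set.Ioo 0 T := fun t ht =>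
    ⟨lt_of_lt_of_le ht₁ ht.1, lt_of_le_of_lt ht.2 ht₂T⟩
  -- (1) `L` is differentiable on `[t₁, t₂]` with derivative `L'`
  have hLd : ∀ t ∈ Set.Icc t₁ t₂, HasDerivAt L (L' t) t := by
    intro t ht
    have htI := hIoo t ht
    refine HasDerivAt.fun_sum fun k _ => HasDerivAt.fun_sum fun i _ => ?_
    have hX := hderiv i k t htI
    have h2 : HasDerivAt (fun s => X i k s ^ 2) (2 * X i k t * circuitRHS lam coeff X i k t) t := by
      simpa using hX.fun_pow 2
    exact h2.const_mul _
  -- (2) the pointwise differential inequality `L' ≥ -C L`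
  have hlow : ∀ t ∈ Set.Icc t₁ t₂, -(C * L t) ≤ L' t := by
    intro t ht
    have htI := hIoo t ht
    have hamp : ∀ (i : Fin m) (j : ℤ), lam ^ ((1 / 5 : ℝ) * j) * |X i j t| ≤ max A 0 :=
      fun i j => (hA t ⟨htI.1.le, htI.2⟩ i j).trans (le_max_left _ _)
    have := tiltedGronwall_deriv_lower hlam1 β coeff hK0 hK X t hA'0 hamp
      (fun i n hn => hcut i n t hn) N
    have e1 : -(C * L t) = -((2 + K * max A 0 * (m : ℝ) ^ 2 * (7 + lam ^ (2 * β))) *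
        lam ^ ((4 / 5 : ℝ) * N) * L t) := by rw [hCdef]
    rw [e1]
    exact this
  -- (3) integrating factor: `g = e^{C t} L` is monotone on `[t₁, t₂]`
  have hg : ∀ t ∈ Set.Icc t₁ t₂, HasDerivAt (fun s => Real.exp (C * s) * L s)
      (Real.exp (C * t) * (C * L t + L' t)) t := by
    intro t ht
    have h1 : HasDerivAt (fun s => C * s) C t := by
      simpa using (hasDerivAt_id t).const_mul C
    have h3 := (h1.exp).fun_mul (hLd t ht)
    exact h3.congr_deriv (by ring)
  have hg0 : ∀ t ∈ Set.Icc t₁ t₂, 0 ≤ Real.exp (C * t) * (C * L t + L' t) := fun t ht =>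
    mul_nonneg (Real.exp_pos _).le (by linarith [hlow t ht])
  have hmono : MonotoneOn (fun s => Real.exp (C * s) * L s) (Set.Icc t₁ t₂) :=
    monotoneOn_of_hasDerivWithinAt_nonneg (convex_Icc t₁ t₂)
      (fun t ht => (hg t ht).continuousAt.continuousWithinAt)
      (fun t ht => (hg t (interior_subset ht)).hasDerivWithinAt)
      (fun t ht => hg0 t (interior_subset ht))
  have hcmp : Real.exp (C * t₁) * L t₁ ≤ Real.exp (C * t₂) * L t₂ :=
    hmono (Set.left_mem_Icc.mpr ht₁₂) (Set.right_mem_Icc.mpr ht₁₂) ht₁₂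
  -- (4) rearrange
  change Real.exp (-(C * (t₂ - t₁))) * L t₁ ≤ L t₂
  have hE : Real.exp (-(C * (t₂ - t₁))) = Real.exp (-(C * t₂)) * Real.exp (C * t₁) := by
    rw [← Real.exp_add]; ring_nf
  calc Real.exp (-(C * (t₂ - t₁))) * L t₁
      = Real.exp (-(C * t₂)) * (Real.exp (C * t₁) * L t₁) := by rw [hE, mul_assoc]
    _ ≤ Real.exp (-(C * t₂)) * (Real.exp (C * t₂) * L t₂) :=
        mul_le_mul_of_nonneg_left hcmp (Real.exp_pos _).le
    _ = L t₂ := by rw [← mul_assoc, ← Real.exp_add, neg_add_cancel, Real.exp_zero, one_mul]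

end Summit.NavierStokesRegularity.NavierStokesRegularity.Theorems.PerpetualPumpCircuitTrace

end
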